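import Mathlib.Analysis.Calculus.Deriv.Mul
import Mathlib.Analysis.Calculus.Deriv.Add
import Mathlib.Analysis.Calculus.Deriv.Pow
import Mathlib.Tactic.Ring
import Mathlib.Tactic.Linarith
import Literature.Algebra.Polynomial.CoeffList
import HarnessLib

/-!
# Coefficient lists, continued: differences, powers, derivatives, and two variables

Topic `Literature/Algebra/Polynomial`; a trunk-independent tool extending
`Literature/Algebra/Polynomial/CoeffList.lean` (the computable model `CoeffList.eval`, `add`,
`smul`, `mul`, `isZero` of `ℤ[t]`) by exactly what a kernel-checked *identity* certificate needs:

* univariate `CoeffList.neg`, `sub`, `pow` with their evaluation lemmas, and the transport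
  `CoeffList.eval_eq_of_isZero_sub` (`isZero (sub p q) = true`, checked by `decide +kernel`,
  gives `eval t p = eval t q` in every commutative ring);
* the formal derivative `CoeffList.derivList` with `CoeffList.hasDerivAt_eval` over `ℝ`;
* the bivariate model `CoeffList₂` — lists of coefficient lists, Horner in the outer variable —
  with `eval`, `add`, `smul`, `neg`, `sub`, `mul`, `pow`, `isZero`, the evaluation homomorphism
  lemmas and `CoeffList₂.eval_eq_of_isZero_sub`.

Compared with the Kronecker certificate (`KroneckerCertificate.lean`, univariate identities in
`R[X]` by one big-integer evaluation) this expands all coefficients; the kernel's integer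
arithmetic does that comfortably up to a few `10⁴` coefficient products (first client: the
degree-166 bivariate identities of the explicit Jacquet–Langlands correspondence for `X_0^{35}`,
`decide +kernel` in < 30 s), and it yields *pointwise* identities in two real variables, which is
the form consumed by change-of-variables arguments.

Everything is proved; folklore (Horner evaluation, proof by reflection). [folklore]
-/

namespace Literature.Algebra.Polynomial

/-! ### Univariate additions -/

namespace CoeffList

variable {R : Type*} [CommRing R]

/-- Negation of a coefficient list. [folklore] -/
def neg (p : List ℤ) : List ℤ := smul (-1) p

/-- Difference of coefficient lists. [folklore] -/
def sub (p q : List ℤ) : List ℤ := add p (neg q)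

/-- Power of a coefficient list. [folklore] -/
def pow (p : List ℤ) : ℕ → List ℤ
  | 0 => [1]
  | n + 1 => mul (pow p n) p

/-- Auxiliary for `derivList`: `derivAux k [a₀, a₁, …] = [k a₀, (k+1) a₁, …]`. [folklore] -/
def derivAux : ℕ → List ℤ → List ℤ
  | _, [] => []
  | k, a :: l => ((k : ℤ) * a) :: derivAux (k + 1) l

/-- Coefficient list of the formal derivative: `derivList [a₀, a₁, a₂, …] = [a₁, 2a₂, 3a₃, …]`.
[folklore] -/
def derivList : List ℤ → List ℤ
  | [] => []
  | _ :: l => derivAux 1 l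

attribute [simp] eval_add eval_smul eval_mul

/-- `eval` of a negation. [folklore] -/
@[simp] theorem eval_neg (x : R) (p : List ℤ) : eval x (neg p) = -eval x p := by
  simp [neg]

/-- `eval` of a difference. [folklore] -/
@[simp] theorem eval_sub (x : R) (p q : List ℤ) : eval x (sub p q) = eval x p - eval x q := by
  simp [sub, sub_eq_add_neg]

/-- `eval` of a power. [folklore] -/
@[simp] theorem eval_pow (x : R) (p : List ℤ) : ∀ n : ℕ, eval x (pow p n) = eval x p ^ n
  | 0 => by simp [pow]
  | n + 1 => by simp [pow, eval_pow x p n, pow_succ]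

/-- **Certificate transport.** `isZero (sub p q) = true` (check it by `decide +kernel`) gives
`eval x p = eval x q` in every commutative ring. [folklore] -/
theorem eval_eq_of_isZero_sub (x : R) (p q : List ℤ) (h : isZero (sub p q) = true) :
    eval x p = eval x q := by
  have h0 := eval_eq_zero_of_isZero x _ h
  rw [eval_sub] at h0
  exact sub_eq_zero.mp h0

/-- Horner form of the derivative recursion: the derivative list of `a :: l` evaluates to
`eval l + x · eval (derivList l)`. [folklore] -/
theorem eval_derivAux_succ (x : R) : ∀ (k : ℕ) (l : List ℤ),
    eval x (derivAux (k + 1) l) = eval x l + eval x (derivAux k l)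
  | k, [] => by simp [derivAux]
  | k, a :: l => by
      simp only [derivAux, eval_cons, eval_derivAux_succ x (k + 1) l, Nat.cast_add, Nat.cast_one,
        Int.cast_mul, Int.cast_add, Int.cast_natCast, Int.cast_one]
      ring

/-- `derivList (a :: l)` evaluates to `eval l + x · eval (derivList l)` (Leibniz for `a + x·l(x)`).
[folklore] -/
theorem eval_derivList_cons (x : R) (a : ℤ) (l : List ℤ) :
    eval x (derivList (a :: l)) = eval x l + x * eval x (derivList l) := by
  cases l with
  | nil => simp [derivList, derivAux]
  | cons b l =>
      simp only [derivList]
      rw [show derivAux 1 (b :: l) = ((1 : ℕ) : ℤ) * b :: derivAux 2 l from rfl, eval_cons,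
        eval_derivAux_succ x 1 l, eval_cons]
      push_cast
      ring

/-- **The derivative of Horner evaluation** over `ℝ`: `u ↦ eval u l` has derivative
`eval u (derivList l)`. [folklore] -/
theorem hasDerivAt_eval (u : ℝ) : ∀ l : List ℤ,
    HasDerivAt (fun v : ℝ => eval v l) (eval u (derivList l)) u
  | [] => by simpa [derivList] using hasDerivAt_const u (0 : ℝ)
  | a :: l => by
      have ih := hasDerivAt_eval u l
      have h1 : HasDerivAt (fun v : ℝ => v * eval v l) (1 * eval u l + u * eval u (derivList l)) u :=
        (hasDerivAt_id u).mul ih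
      have h2 := (hasDerivAt_const u ((a : ℤ) : ℝ)).add h1
      rw [eval_derivList_cons]
      refine h2.congr_deriv ?_
      ring

end CoeffList

/-! ### Bivariate lists: coefficients in the outer variable are univariate lists -/

namespace CoeffList₂

variable {R : Type*} [CommRing R]

/-- Horner evaluation in the outer variable `y`, the coefficients being evaluated at `x`:
`eval x y [p₀, p₁, …] = eval x p₀ + y (eval x p₁ + y (…))`. [folklore] -/
def eval (x y : R) : List (List ℤ) → R
  | [] => 0
  | p :: L => CoeffList.eval x p + y * eval x y L

/-- Coefficientwise sum. [folklore] -/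
def add : List (List ℤ) → List (List ℤ) → List (List ℤ)
  | [], L => L
  | p :: P, [] => p :: P
  | p :: P, q :: Q => CoeffList.add p q :: add P Q

/-- Multiplication by a univariate coefficient. [folklore] -/
def smul (c : List ℤ) : List (List ℤ) → List (List ℤ)
  | [] => []
  | p :: P => CoeffList.mul c p :: smul c P

/-- Negation. [folklore] -/
def neg (P : List (List ℤ)) : List (List ℤ) := smul [-1] P

/-- Difference. [folklore] -/
def sub (P Q : List (List ℤ)) : List (List ℤ) := add P (neg Q)

/-- Product. [folklore] -/
def mul : List (List ℤ) → List (List ℤ) → List (List ℤ)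
  | [], _ => []
  | p :: P, Q => add (smul p Q) ([] :: mul P Q)

/-- Power. [folklore] -/
def pow (P : List (List ℤ)) : ℕ → List (List ℤ)
  | 0 => [[1]]
  | n + 1 => mul (pow P n) P

/-- Test that all coefficients vanish. [folklore] -/
def isZero (P : List (List ℤ)) : Bool := P.all CoeffList.isZero

/-- `eval x y [] = 0`. [folklore] -/
@[simp] theorem eval_nil (x y : R) : eval x y [] = 0 := rfl

/-- `eval x y (p :: L) = eval x p + y · eval x y L`. [folklore] -/
@[simp] theorem eval_cons (x y : R) (p : List ℤ) (L : List (List ℤ)) :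
    eval x y (p :: L) = CoeffList.eval x p + y * eval x y L := rfl

/-- `eval` is additive. [folklore] -/
@[simp] theorem eval_add (x y : R) : ∀ P Q, eval x y (add P Q) = eval x y P + eval x y Q
  | [], Q => by simp [add]
  | p :: P, [] => by simp [add]
  | p :: P, q :: Q => by
      simp only [add, eval_cons, CoeffList.eval_add, eval_add x y P Q]
      ring

/-- `eval` commutes with univariate scalars. [folklore] -/
@[simp] theorem eval_smul (x y : R) (c : List ℤ) :
    ∀ P, eval x y (smul c P) = CoeffList.eval x c * eval x y P
  | [] => by simp [smul]
  | p :: P => by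
      simp only [smul, eval_cons, CoeffList.eval_mul, eval_smul x y c P]
      ring

/-- `eval` of a negation. [folklore] -/
@[simp] theorem eval_neg (x y : R) (P) : eval x y (neg P) = -eval x y P := by
  simp [neg]

/-- `eval` of a difference. [folklore] -/
@[simp] theorem eval_sub (x y : R) (P Q) : eval x y (sub P Q) = eval x y P - eval x y Q := by
  simp [sub, sub_eq_add_neg]

/-- `eval` is multiplicative. [folklore] -/
@[simp] theorem eval_mul (x y : R) : ∀ P Q, eval x y (mul P Q) = eval x y P * eval x y Q
  | [], Q => by simp [mul]
  | p :: P, Q => by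
      simp only [mul, eval_add, eval_smul, eval_cons, eval_mul x y P Q, CoeffList.eval_nil]
      ring

/-- `eval` of a power. [folklore] -/
@[simp] theorem eval_pow (x y : R) (P) : ∀ n : ℕ, eval x y (pow P n) = eval x y P ^ n
  | 0 => by simp [pow]
  | n + 1 => by simp [pow, eval_pow x y P n, pow_succ]

/-- A bivariate list all of whose coefficients vanish evaluates to zero. [folklore] -/
theorem eval_eq_zero_of_isZero (x y : R) : ∀ P, isZero P = true → eval x y P = 0
  | [], _ => rfl
  | p :: P, h => by
      simp only [isZero, List.all_cons, Bool.and_eq_true] at h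
      have hP : isZero P = true := by simpa [isZero] using h.2
      simp [CoeffList.eval_eq_zero_of_isZero x p h.1, eval_eq_zero_of_isZero x y P hP]

/-- **Certificate transport in two variables.** [folklore] -/
theorem eval_eq_of_isZero_sub (x y : R) (P Q) (h : isZero (sub P Q) = true) :
    eval x y P = eval x y Q := by
  have h0 := eval_eq_zero_of_isZero x y _ h
  rw [eval_sub] at h0
  exact sub_eq_zero.mp h0

end CoeffList₂

end Literature.Algebra.Polynomial
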